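import Literature.AnabelianGeometry.EtaleTheta.Discharge.Sec1FreeTwoHeisenbergZHat
import Literature.AnabelianGeometry.AbsoluteAnabelian.ZHatCompletionAdicCompleteness
import HarnessLib

/-!
# [EtTh] §1 p. 12: the tempered `Δ_Θ` (and `l·Δ_Θ`) has no infinitely divisible elements

Mochizuki, *The étale theta function and its Frobenioid-theoretic manifestations*, Publ. RIMS **45**
(2009), §1, PRIMS PDF p. 12 (printed 238): "`(Ẑ(1) ≅) Δ_Θ ⊆ Δ^Θ_X`" [cite: MochizukiEtTh2009, §1 p.12].
Layer L2 of the abc-iut cell; PROOF-ONLY companion of `Setting.lean` (abc-iut-L2-t1) and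
`ThetaCyclotomes.lean` (abc-iut-L2-t8), in the spirit of `Sec2DeltaThetaTorsionFree.lean`
(`deltaTheta_torsionfree`, abc-iut-L2-t8) — same mechanism, one level deeper:

* `ThetaSetting.mem_tripleCommutatorClosure_of_forall_exists_pow_mul` — in the profinite
  `K₂/K₃ = [Δ_X,Δ_X]⁻/[[Δ_X,Δ_X],Δ_X]⁻ ≅ Ẑ` (abc-iut-w5-d171's `IsEtThOrigin.exists_hom_commutatorClosure_zHat`)
  there is no infinitely divisible element (the tree's `ZHatCompletion.eq_one_of_forall_exists_pow_eq`,
  `⋂_M Ẑ^M = 1`, `ZHatCompletionAdicCompleteness.lean`):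
  if `c ∈ K₂` lies in `y_M^M · K₃` with `y_M ∈ K₂` for every `M ≥ 1`, then `c ∈ K₃`;
* `ThetaSetting.deltaTheta_eq_one_of_forall_exists_pow_eq` — hence, by the printed kernels of the root
  axioms (`ker_toTheta`, `ker_toEll`), the TEMPERED `Δ_Θ = Ker((Π^tp_X)^Θ ↠ (Π^tp_X)^ell)` has no element
  `≠ 1` that is an `M`-th power in `Δ_Θ` for every `M ≥ 1` (`⋂_M Δ_Θ^M = 1`) — under the freeness
  guard `IsEtThOrigin` ONLY (no closedness binder `hYcl`: an EMBEDDING of `Δ_Θ` into `K₂/K₃` suffices,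
  whereas "`Δ_Θ ≅ Ẑ`" needs `hYcl`, cf. `Sec1DeltaThetaZHat.lean`);
* `ThetaSetting.lDeltaTheta_eq_one_of_forall_exists_pow_eq` — the same for `l·Δ_Θ`.

CONSUMER: joint injectivity of the cyclotome identifications `(l·Δ_Θ) ↠ μ_M`, `M ≥ 1`
(`CyclotomeMod.red_ker`: kernel = `M`-th powers) of a `CyclotomeTower` — the step from "Galois-fixed"
to "trivial" in the cell's discharge of the «cyclotomic no-invariants» hypothesis at the [IUTchII] model
(`Literature/IUT/HodgeArakelov/EtaleThetaDataOfSettingCyclotomeTower.lean`).  HONEST FRAMING: [EtTh] is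
refereed; the theta setting is data quoting print; nothing here concerns [IUTchIII] Cor. 3.12.
-/

noncomputable section

namespace Literature.AnabelianGeometry.EtaleTheta

open Literature.AnabelianGeometry.AbsoluteAnabelian

namespace ThetaSetting

variable {p : ℕ} [Fact p.Prime] (D : ThetaSetting p)

/-- **`[Δ_X,Δ_X]⁻/[[Δ_X,Δ_X],Δ_X]⁻` has no infinitely divisible element** ("`∧² Δ^ell_X (≅ Ẑ(1))`",
p. 12): under the freeness guard, if `c ∈ [Δ_X,Δ_X]⁻` satisfies `(y_M^M)⁻¹ c ∈ [[Δ_X,Δ_X],Δ_X]⁻` for some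
`y_M ∈ [Δ_X,Δ_X]⁻`, for every `M ≥ 1`, then `c ∈ [[Δ_X,Δ_X],Δ_X]⁻` (the quotient is `≅ Ẑ`, and
`⋂_M Ẑ^M = 1`). [cite: MochizukiEtTh2009, §1 p.12] -/
theorem mem_tripleCommutatorClosure_of_forall_exists_pow_mul (hO : D.IsEtThOrigin) {c : D.PiHat}
    (hc : c ∈ (⁅D.DeltaHat, D.DeltaHat⁆).topologicalClosure)
    (hdiv : ∀ M : ℕ, 0 < M → ∃ y ∈ (⁅D.DeltaHat, D.DeltaHat⁆).topologicalClosure,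
      (y ^ M)⁻¹ * c ∈ (⁅⁅D.DeltaHat, D.DeltaHat⁆, D.DeltaHat⁆).topologicalClosure) :
    c ∈ (⁅⁅D.DeltaHat, D.DeltaHat⁆, D.DeltaHat⁆).topologicalClosure := by
  obtain ⟨-, -, φ, -, -, hφk, -⟩ := hO.exists_hom_commutatorClosure_zHat
  refine (hφk ⟨c, hc⟩).mp (ZHatCompletion.eq_one_of_forall_exists_pow_eq fun M hM => ?_)
  obtain ⟨y, hy, hk⟩ := hdiv M hM
  have hkmem : (y ^ M)⁻¹ * c ∈ (⁅D.DeltaHat, D.DeltaHat⁆).topologicalClosure :=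
    Subgroup.mul_mem _ (Subgroup.inv_mem _ (Subgroup.pow_mem _ hy M)) hc
  have hφk1 : φ ⟨(y ^ M)⁻¹ * c, hkmem⟩ = 1 := (hφk ⟨(y ^ M)⁻¹ * c, hkmem⟩).mpr hk
  refine ⟨φ ⟨y, hy⟩, ?_⟩
  have hprod : (⟨c, hc⟩ : ↥((⁅D.DeltaHat, D.DeltaHat⁆).topologicalClosure)) =
      ⟨y, hy⟩ ^ M * ⟨(y ^ M)⁻¹ * c, hkmem⟩ :=
    Subtype.ext (by simp [mul_inv_cancel_left])
  rw [hprod, map_mul, map_pow, hφk1, mul_one]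

/-- **The tempered `Δ_Θ` has no infinitely divisible element** ("`(Ẑ(1) ≅) Δ_Θ`", p. 12): under the
freeness guard `IsEtThOrigin`, an element of `Δ_Θ = Ker((Π^tp_X)^Θ ↠ (Π^tp_X)^ell)` which is an `M`-th
power of an element of `Δ_Θ` for every `M ≥ 1` is trivial — `Δ_Θ` embeds (by the printed kernels
`ker_toTheta`, `ker_toEll` of `Setting.lean`) into `[Δ_X,Δ_X]⁻/[[Δ_X,Δ_X],Δ_X]⁻`, which has no
divisible elements.  No closedness binder `hYcl` is needed. [cite: MochizukiEtTh2009, §1 p.12] -/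
theorem deltaTheta_eq_one_of_forall_exists_pow_eq (hO : D.IsEtThOrigin) {t : D.GtpTheta}
    (ht : t ∈ D.DeltaTheta) (hdiv : ∀ M : ℕ, 0 < M → ∃ s ∈ D.DeltaTheta, t = s ^ M) : t = 1 := by
  obtain ⟨g, rfl⟩ := D.toTheta_surjective t
  have hg : g ∈ (D.thetaToEll.comp D.toTheta).ker := ht
  rw [D.ker_toEll, Subgroup.mem_comap] at hg
  have hmem : D.toHat.toMonoidHom g ∈ (⁅⁅D.DeltaHat, D.DeltaHat⁆, D.DeltaHat⁆).topologicalClosure := by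
    refine D.mem_tripleCommutatorClosure_of_forall_exists_pow_mul hO hg fun M hM => ?_
    obtain ⟨s, hs, hsM⟩ := hdiv M hM
    obtain ⟨g', rfl⟩ := D.toTheta_surjective s
    have hg' : g' ∈ (D.thetaToEll.comp D.toTheta).ker := hs
    rw [D.ker_toEll, Subgroup.mem_comap] at hg'
    refine ⟨D.toHat.toMonoidHom g', hg', ?_⟩
    have hker : (g' ^ M)⁻¹ * g ∈ D.toTheta.ker := by
      rw [MonoidHom.mem_ker, map_mul, map_inv, map_pow, ← hsM, inv_mul_cancel]
    rw [D.ker_toTheta, Subgroup.mem_comap, map_mul, map_inv, map_pow] at hker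
    exact hker
  have hgker : g ∈ D.toTheta.ker := by
    rw [D.ker_toTheta, Subgroup.mem_comap]
    exact hmem
  exact hgker

/-- **`l·Δ_Θ` has no infinitely divisible element**: an element of `l·Δ_Θ` which is an `M`-th power in
`l·Δ_Θ` for every `M ∈ ℕ≥1` is trivial (`l·Δ_Θ ⊆ Δ_Θ`, `ThetaSetting.lDeltaTheta_le`).  This is the
joint-injectivity input for a family of cyclotome identifications `(l·Δ_Θ) ↠ μ_M` with kernels the
`M`-th powers (`CyclotomeMod.red_ker`). [cite: MochizukiEtTh2009, §1 p.12] -/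
theorem lDeltaTheta_eq_one_of_forall_exists_pow_eq (hO : D.IsEtThOrigin) {l : ℕ}
    (a : ↥(D.lDeltaTheta l)) (hdiv : ∀ M : ℕ+, ∃ y : ↥(D.lDeltaTheta l), a = y ^ (M : ℕ)) :
    a = 1 := by
  apply Subtype.ext
  refine D.deltaTheta_eq_one_of_forall_exists_pow_eq hO (D.lDeltaTheta_le l a.2) fun M hM => ?_
  obtain ⟨y, hy⟩ := hdiv ⟨M, hM⟩
  exact ⟨(y : D.GtpTheta), D.lDeltaTheta_le l y.2, by rw [hy, SubmonoidClass.coe_pow]; rfl⟩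

end ThetaSetting

end Literature.AnabelianGeometry.EtaleTheta
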